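import Mathlib.Analysis.Calculus.ContDiff.Basic
import Mathlib.Analysis.Normed.Operator.LinearIsometry
import HarnessLib

/-!
# `C^n` maps with values in a closed subspace are `C^n` into the subspace

Topic `Literature/Analysis/Calculus` (namespace `Literature.Analysis.Calculus`); pure
Mathlib-level calculus over a nontrivially normed field `𝕜`, no completeness assumptions.

Let `S` be a closed submodule of a normed space `Z` and `f : X → Z` a map with `f x ∈ S` for all
`x`; write `f♭ : X → ↥S`, `f♭ x = ⟨f x, _⟩`, for the codomain restriction (`↥S` with Mathlib's
induced normed structure, `S.subtypeL : ↥S →L[𝕜] Z` the inclusion). This file proves: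

* `hasFDerivWithinAt_codRestrict` (and the `HasFDerivAtFilter` / `HasFDerivAt` /
  `HasStrictFDerivAt` forms): if `f` has derivative `f'` and `f'` takes values in `S`, then `f♭`
  has derivative `f'.codRestrict S _` (the remainders have the same norm);
* `mem_of_hasFDerivWithinAt_of_isClosed`, `fderivWithin_mem_of_isClosed`,
  `fderiv_mem_of_isClosed`: at a point of unique differentiability the derivative within `s` of a
  map sending `s` into the CLOSED submodule `S` takes values in `S` (it is a limit of rescaled
  differences on a dense set of directions, `HasFDerivWithinAt.lim`);
* `ContDiffOn.codRestrict_submodule` (**main**), `ContDiff.codRestrict_submodule`,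
  `ContDiffAt.codRestrict_submodule`, `ContDiffWithinAt.codRestrict_submodule` and the iff forms
  `contDiffOn_codRestrict_submodule_iff`, `contDiff_codRestrict_submodule_iff`: for `n : ℕ∞` and
  `s` of unique differentiability, `f` is `C^n` on `s` iff `f♭` is;
* `fderiv_codRestrict`, `hasFDerivAt_codRestrict_fderiv`,
  `hasFDerivWithinAt_codRestrict_fderivWithin`: `D(f♭) = (Df).codRestrict S _`;
* `ContDiffOn.subtype_mk_of_isClosed`, `ContDiff.subtype_mk_of_isClosed`,
  `ContDiffAt.subtype_mk_of_isClosed`: the componentwise special case of a closed submodule `p`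
  of a product `A × B` and a pair of `C^n` maps `(f₁, f₂)` with values in `p`.

Everything is deduced from the version for a LINEAR ISOMETRY `ι : F →ₗᵢ[𝕜] G` with closed range
in place of the inclusion `↥S → Z` (`contDiffOn_of_linearIsometry_comp`,
`contDiffOn_linearIsometry_comp_iff`, `contDiff(WithinAt|At)_of_linearIsometry_comp`,
`hasFDerivAtFilter_linearIsometry_comp_iff`, `differentiableWithinAt_of_linearIsometry_comp`,
`fderivWithin_linearIsometry_comp`): by induction on `m`, the `m`-th derivative within `s` of
`ι ∘ g` is the post-composition with `ι` of that of `g`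
(`iteratedFDerivWithin_linearIsometry_comp_step`; the derivative of the former takes values in
the closed range of post-composition, `isClosed_range_compContinuousMultilinearMap`, hence
factors through it, `exists_linearIsometry_comp_eq`), so that continuity and differentiability
of the iterated derivatives transfer (`contDiffOn_iff_continuousOn_differentiableOn`). The
isometry form is the one that iterates, since `X →L[𝕜] ↥S` is not literally a submodule of
`X →L[𝕜] Z`.

Not treated: the analytic case `n = ω` (all `C^n` statements are for `n : ℕ∞`), and sets
without unique differentiability (there the Taylor fields of `f` need not take values in `S`).

## Mathlib search

Mathlib (at the pin of this tree) has the converse direction (`ContDiff*.continuousLinearMap_comp`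
with `S.subtypeL`), the equivalence case (`ContinuousLinearEquiv.comp_contDiff*_iff`,
`ContinuousLinearEquiv.iteratedFDerivWithin_comp_left`), the first-order embedding case
(`HasFDerivWithinAt.of_comp_of_isEmbedding`, file `FDeriv/OfCompLeft.lean`), the codomain
restrictions `ContinuousLinearMap.codRestrict` / `ContinuousMultilinearMap.codRestrict`,
`LinearIsometry.equivRange` and `LinearIsometry.norm_compContinuousMultilinearMap`; searched
`codRestrict`, `contDiff.*[sS]ubtype`, `LinearIsometry.*contDiff`, `Isometry.*contDiff`: no
`C^n` statement for maps into a closed subspace / through an isometric embedding.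

## References

* H. Cartan, *Calcul différentiel*, Hermann 1967, Ch. I §2 and §5 (derivatives of maps into
  closed subspaces and products; higher derivatives). [folklore]
* J. Dieudonné, *Foundations of Modern Analysis*, Academic Press 1960, (8.1)–(8.12). [folklore]
-/

open Set Filter Function
open scoped Topology ContDiff

namespace Literature.Analysis.Calculus

variable {𝕜 : Type*} [NontriviallyNormedField 𝕜]
  {X : Type*} [NormedAddCommGroup X] [NormedSpace 𝕜 X]
  {F : Type*} [NormedAddCommGroup F] [NormedSpace 𝕜 F]
  {G : Type*} [NormedAddCommGroup G] [NormedSpace 𝕜 G]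
  {Z : Type*} [NormedAddCommGroup Z] [NormedSpace 𝕜 Z]

/-! ## Derivatives of maps with values in a closed submodule -/

/-- If `f` has derivative `f'` at `x` within a set `s` of unique differentiability at `x`, and
`f` takes values in a closed submodule `S` at `x` and near `x` within `s`, then `f'` takes values
in `S`: on tangent directions `f' v` is a limit of rescaled differences `c • (f y - f x) ∈ S`
(`HasFDerivWithinAt.lim`), tangent directions span a dense subspace, and `f' ⁻¹ S` is a closed
submodule. [folklore] -/
theorem mem_of_hasFDerivWithinAt_of_isClosed (S : Submodule 𝕜 Z) (hS : IsClosed (S : Set Z))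
    {f : X → Z} {f' : X →L[𝕜] Z} {s : Set X} {x : X} (h : HasFDerivWithinAt f f' s x)
    (hu : UniqueDiffWithinAt 𝕜 s x) (hfx : f x ∈ S) (hf : ∀ᶠ y in 𝓝[s] x, f y ∈ S) (v : X) :
    f' v ∈ S := by
  have hT : ∀ y ∈ tangentConeAt 𝕜 s x, f' y ∈ S := by
    intro y hy
    obtain ⟨α, l, hl, c, d, hd₀, hds, hcd⟩ := exists_fun_of_mem_tangentConeAt hy
    have hxd : Tendsto (fun n => x + d n) l (𝓝[s] x) :=
      tendsto_nhdsWithin_iff.2 ⟨by simpa using tendsto_const_nhds.add hd₀, hds⟩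
    refine hS.mem_of_tendsto (h.lim hd₀ hds hcd) ?_
    filter_upwards [hxd.eventually hf] with n hn
    exact S.smul_mem _ (S.sub_mem hn hfx)
  have hle : (Submodule.span 𝕜 (tangentConeAt 𝕜 s x) : Set X) ⊆
      (S.comap (f' : X →ₗ[𝕜] Z) : Set X) :=
    Submodule.span_le.2 hT
  have hcl : IsClosed ((S.comap (f' : X →ₗ[𝕜] Z) : Submodule 𝕜 X) : Set X) :=
    hS.preimage f'.continuous
  have hv : v ∈ closure ((S.comap (f' : X →ₗ[𝕜] Z) : Submodule 𝕜 X) : Set X) :=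
    closure_mono hle (hu.dense_tangentConeAt v)
  rw [hcl.closure_eq] at hv
  exact hv

/-- If `f` has derivative `f'` at `x ∈ s` within a set `s` of unique differentiability at `x`
and `f` maps `s` into a closed submodule `S`, then `f'` takes values in `S`. [folklore] -/
theorem mem_of_hasFDerivWithinAt_of_isClosed' (S : Submodule 𝕜 Z) (hS : IsClosed (S : Set Z))
    {f : X → Z} {f' : X →L[𝕜] Z} {s : Set X} {x : X} (h : HasFDerivWithinAt f f' s x)
    (hu : UniqueDiffWithinAt 𝕜 s x) (hx : x ∈ s) (hf : ∀ y ∈ s, f y ∈ S) (v : X) :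
    f' v ∈ S :=
  mem_of_hasFDerivWithinAt_of_isClosed S hS h hu (hf x hx)
    (eventually_mem_nhdsWithin.mono hf) v

/-- If `f` has derivative `f'` at `x` and takes values in a closed submodule `S` near `x`, then
`f'` takes values in `S`. [folklore] -/
theorem mem_of_hasFDerivAt_of_isClosed (S : Submodule 𝕜 Z) (hS : IsClosed (S : Set Z))
    {f : X → Z} {f' : X →L[𝕜] Z} {x : X} (h : HasFDerivAt f f' x) (hf : ∀ᶠ y in 𝓝 x, f y ∈ S)
    (v : X) : f' v ∈ S :=
  mem_of_hasFDerivWithinAt_of_isClosed S hS h.hasFDerivWithinAt uniqueDiffWithinAt_univ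
    hf.self_of_nhds (by rwa [nhdsWithin_univ]) v

/-- The derivative within a set `s` (of unique differentiability at `x ∈ s`) of a map sending
`s` into a closed submodule `S` takes values in `S` (no differentiability hypothesis: the junk
value `0` lies in `S`). [folklore] -/
theorem fderivWithin_mem_of_isClosed (S : Submodule 𝕜 Z) (hS : IsClosed (S : Set Z))
    {f : X → Z} {s : Set X} {x : X} (hu : UniqueDiffWithinAt 𝕜 s x) (hx : x ∈ s)
    (hf : ∀ y ∈ s, f y ∈ S) (v : X) : fderivWithin 𝕜 f s x v ∈ S := by
  by_cases hd : DifferentiableWithinAt 𝕜 f s x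
  · exact mem_of_hasFDerivWithinAt_of_isClosed' S hS hd.hasFDerivWithinAt hu hx hf v
  · rw [fderivWithin_zero_of_not_differentiableWithinAt hd]
    exact S.zero_mem

/-- The derivative of a map with values in a closed submodule `S` takes values in `S`.
[folklore] -/
theorem fderiv_mem_of_isClosed (S : Submodule 𝕜 Z) (hS : IsClosed (S : Set Z)) {f : X → Z}
    {x : X} (hf : ∀ y, f y ∈ S) (v : X) : fderiv 𝕜 f x v ∈ S := by
  rw [← fderivWithin_univ]
  exact fderivWithin_mem_of_isClosed S hS uniqueDiffWithinAt_univ (mem_univ x) (fun y _ => hf y) v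

/-! ## Composition with a linear isometry on the left -/

/-- For a linear isometry `ι`, `ι ∘ g` has derivative `ι ∘ g'` along a filter iff `g` has
derivative `g'` (the two remainders have the same norm). [folklore] -/
theorem hasFDerivAtFilter_linearIsometry_comp_iff (ι : F →ₗᵢ[𝕜] G) {g : X → F}
    {g' : X →L[𝕜] F} {L : Filter (X × X)} :
    HasFDerivAtFilter (ι ∘ g) (ι.toContinuousLinearMap.comp g') L ↔ HasFDerivAtFilter g g' L := by
  simp only [hasFDerivAtFilter_iff_isLittleO]
  constructor <;> intro h
  · refine Asymptotics.IsLittleO.of_norm_left (h.norm_left.congr_left fun p => ?_)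
    simp only [comp_apply, ContinuousLinearMap.coe_comp, LinearIsometry.coe_toContinuousLinearMap]
    rw [← map_sub, ← map_sub, LinearIsometry.norm_map]
  · refine Asymptotics.IsLittleO.of_norm_left (h.norm_left.congr_left fun p => ?_)
    simp only [comp_apply, ContinuousLinearMap.coe_comp, LinearIsometry.coe_toContinuousLinearMap]
    rw [← map_sub, ← map_sub, LinearIsometry.norm_map]

/-- For a linear isometry `ι`, `ι ∘ g` has derivative `ι ∘ g'` within `s` at `x` iff `g` has
derivative `g'` within `s` at `x`. [folklore] -/
theorem hasFDerivWithinAt_linearIsometry_comp_iff (ι : F →ₗᵢ[𝕜] G) {g : X → F}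
    {g' : X →L[𝕜] F} {s : Set X} {x : X} :
    HasFDerivWithinAt (ι ∘ g) (ι.toContinuousLinearMap.comp g') s x ↔
      HasFDerivWithinAt g g' s x :=
  hasFDerivAtFilter_linearIsometry_comp_iff ι

/-- For a linear isometry `ι`, `ι ∘ g` has derivative `ι ∘ g'` at `x` iff `g` has derivative `g'`
at `x`. [folklore] -/
theorem hasFDerivAt_linearIsometry_comp_iff (ι : F →ₗᵢ[𝕜] G) {g : X → F} {g' : X →L[𝕜] F}
    {x : X} :
    HasFDerivAt (ι ∘ g) (ι.toContinuousLinearMap.comp g') x ↔ HasFDerivAt g g' x :=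
  hasFDerivAtFilter_linearIsometry_comp_iff ι

/-- For a linear isometry `ι`, `ι ∘ g` has strict derivative `ι ∘ g'` at `x` iff `g` has strict
derivative `g'` at `x`. [folklore] -/
theorem hasStrictFDerivAt_linearIsometry_comp_iff (ι : F →ₗᵢ[𝕜] G) {g : X → F}
    {g' : X →L[𝕜] F} {x : X} :
    HasStrictFDerivAt (ι ∘ g) (ι.toContinuousLinearMap.comp g') x ↔ HasStrictFDerivAt g g' x :=
  hasFDerivAtFilter_linearIsometry_comp_iff ι

/-- A continuous linear map with values in the range of a linear isometry `ι` factors through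
`ι`. [folklore] -/
theorem exists_linearIsometry_comp_eq (ι : F →ₗᵢ[𝕜] G) (T : X →L[𝕜] G)
    (hT : ∀ v, T v ∈ Set.range ι) :
    ∃ U : X →L[𝕜] F, ι.toContinuousLinearMap.comp U = T := by
  have hT' : ∀ v, T v ∈ LinearMap.range ι.toLinearMap := fun v => by
    simpa [LinearMap.mem_range] using hT v
  refine ⟨(ι.equivRange.symm.toContinuousLinearEquiv : _ →L[𝕜] F).comp (T.codRestrict _ hT'),
    ?_⟩
  ext v
  have h1 := ι.equivRange_apply_coe (ι.equivRange.symm ⟨T v, hT' v⟩)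
  rw [LinearIsometryEquiv.apply_symm_apply] at h1
  exact h1.symm

/-- A continuous multilinear map with values in the range of a linear isometry `ι` factors
through `ι`. [folklore] -/
theorem exists_compContinuousMultilinearMap_eq {ι' : Type*} [Fintype ι'] {E : ι' → Type*}
    [∀ i, NormedAddCommGroup (E i)] [∀ i, NormedSpace 𝕜 (E i)] (ι : F →ₗᵢ[𝕜] G)
    (T : ContinuousMultilinearMap 𝕜 E G) (hT : ∀ v, T v ∈ Set.range ι) :
    ∃ U : ContinuousMultilinearMap 𝕜 E F,
      ι.toContinuousLinearMap.compContinuousMultilinearMap U = T := by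
  have hT' : ∀ v, T v ∈ LinearMap.range ι.toLinearMap := fun v => by
    simpa [LinearMap.mem_range] using hT v
  refine ⟨(ι.equivRange.symm.toContinuousLinearEquiv : _ →L[𝕜] F).compContinuousMultilinearMap
    (T.codRestrict _ hT'), ?_⟩
  ext v
  have h1 := ι.equivRange_apply_coe (ι.equivRange.symm ⟨T v, hT' v⟩)
  rw [LinearIsometryEquiv.apply_symm_apply] at h1
  exact h1.symm

/-- If a linear isometry `ι` has closed range, so does post-composition with `ι` on continuous
multilinear maps: its range is `⋂ᵥ {T | T v ∈ range ι}`. [folklore] -/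
theorem isClosed_range_compContinuousMultilinearMap {ι' : Type*} [Fintype ι'] {E : ι' → Type*}
    [∀ i, NormedAddCommGroup (E i)] [∀ i, NormedSpace 𝕜 (E i)] (ι : F →ₗᵢ[𝕜] G)
    (hι : IsClosed (Set.range ι)) :
    IsClosed (Set.range fun U : ContinuousMultilinearMap 𝕜 E F =>
      ι.toContinuousLinearMap.compContinuousMultilinearMap U) := by
  have : (Set.range fun U : ContinuousMultilinearMap 𝕜 E F =>
        ι.toContinuousLinearMap.compContinuousMultilinearMap U) =
      ⋂ v, (fun T : ContinuousMultilinearMap 𝕜 E G => T v) ⁻¹' Set.range ι := by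
    ext T
    simp only [Set.mem_range, Set.mem_iInter, Set.mem_preimage]
    constructor
    · rintro ⟨U, rfl⟩ v
      exact ⟨U v, by simp⟩
    · exact fun h => exists_compContinuousMultilinearMap_eq ι T h
  rw [this]
  exact isClosed_iInter fun v => hι.preimage (continuous_eval_const v)

/-- If `ι` is a linear isometry with closed range and `ι ∘ g` is differentiable within a set `s`
of unique differentiability at `x ∈ s`, then so is `g`: the derivative of `ι ∘ g` takes values
in `range ι`, hence factors through `ι`. [folklore] -/
theorem differentiableWithinAt_of_linearIsometry_comp (ι : F →ₗᵢ[𝕜] G)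
    (hι : IsClosed (Set.range ι)) {g : X → F} {s : Set X} {x : X}
    (hu : UniqueDiffWithinAt 𝕜 s x) (hx : x ∈ s) (h : DifferentiableWithinAt 𝕜 (ι ∘ g) s x) :
    DifferentiableWithinAt 𝕜 g s x := by
  have hmem : ∀ v, fderivWithin 𝕜 (ι ∘ g) s x v ∈ Set.range ι := by
    have hcl : IsClosed ((LinearMap.range ι.toLinearMap : Submodule 𝕜 G) : Set G) := by
      rw [LinearMap.coe_range]; exact hι
    intro v
    exact fderivWithin_mem_of_isClosed (f := ι ∘ g) (LinearMap.range ι.toLinearMap) hcl hu hx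
      (fun y _ => LinearMap.mem_range_self ι.toLinearMap (g y)) v
  obtain ⟨U, hU⟩ := exists_linearIsometry_comp_eq ι _ hmem
  have h' := h.hasFDerivWithinAt
  rw [← hU] at h'
  exact ((hasFDerivWithinAt_linearIsometry_comp_iff ι).1 h').differentiableWithinAt

/-- For a linear isometry `ι` and `g` differentiable within `s` at a point of unique
differentiability, `D(ι ∘ g) = ι ∘ Dg` within `s`. [folklore] -/
theorem fderivWithin_linearIsometry_comp (ι : F →ₗᵢ[𝕜] G) {g : X → F} {s : Set X} {x : X}
    (hu : UniqueDiffWithinAt 𝕜 s x) (h : DifferentiableWithinAt 𝕜 g s x) :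
    fderivWithin 𝕜 (ι ∘ g) s x = ι.toContinuousLinearMap.comp (fderivWithin 𝕜 g s x) := by
  rw [show (ι : F → G) ∘ g = ι.toContinuousLinearMap ∘ g from rfl,
    fderiv_comp_fderivWithin x ι.toContinuousLinearMap.differentiableAt h hu,
    ContinuousLinearMap.fderiv]

/-- Inductive step of `contDiffOn_of_linearIsometry_comp`: if the `m`-th derivatives within `s`
of `ι ∘ g` and `g` are related by post-composition with `ι` on `s` and the former is
differentiable within `s` at `x ∈ s`, then so is the latter, and the `(m+1)`-st derivatives at
`x` are again related by post-composition with `ι`. [folklore] -/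
theorem iteratedFDerivWithin_linearIsometry_comp_step (ι : F →ₗᵢ[𝕜] G)
    (hι : IsClosed (Set.range ι)) {g : X → F} {s : Set X} {x : X}
    (hu : UniqueDiffWithinAt 𝕜 s x) (hx : x ∈ s) {m : ℕ}
    (hEq : EqOn (iteratedFDerivWithin 𝕜 m (ι ∘ g) s)
      (fun y => ι.toContinuousLinearMap.compContinuousMultilinearMap
        (iteratedFDerivWithin 𝕜 m g s y)) s)
    (hd : DifferentiableWithinAt 𝕜 (iteratedFDerivWithin 𝕜 m (ι ∘ g) s) s x) :
    DifferentiableWithinAt 𝕜 (iteratedFDerivWithin 𝕜 m g s) s x ∧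
      iteratedFDerivWithin 𝕜 (m + 1) (ι ∘ g) s x =
        ι.toContinuousLinearMap.compContinuousMultilinearMap
          (iteratedFDerivWithin 𝕜 (m + 1) g s x) := by
  -- post-composition with `ι` at level `m`, bundled as a linear isometry
  obtain ⟨Λ, hΛ⟩ : ∃ Λ : (X [×m]→L[𝕜] F) →ₗᵢ[𝕜] (X [×m]→L[𝕜] G),
      ∀ U, Λ U = ι.toContinuousLinearMap.compContinuousMultilinearMap U :=
    ⟨⟨(ContinuousLinearMap.compContinuousMultilinearMapL 𝕜 (fun _ : Fin m => X) F G
        ι.toContinuousLinearMap).toLinearMap, fun U => ι.norm_compContinuousMultilinearMap U⟩,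
      fun _ => rfl⟩
  have hΛcl : IsClosed (Set.range Λ) := by
    have : (Λ : (X [×m]→L[𝕜] F) → (X [×m]→L[𝕜] G)) =
        fun U => ι.toContinuousLinearMap.compContinuousMultilinearMap U := funext hΛ
    rw [this]
    exact isClosed_range_compContinuousMultilinearMap ι hι
  have hEq' : EqOn (iteratedFDerivWithin 𝕜 m (ι ∘ g) s) (Λ ∘ iteratedFDerivWithin 𝕜 m g s) s :=
    fun y hy => (hEq hy).trans (hΛ _).symm
  have hdΛ : DifferentiableWithinAt 𝕜 (Λ ∘ iteratedFDerivWithin 𝕜 m g s) s x :=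
    hd.congr (fun y hy => (hEq' hy).symm) (hEq' hx).symm
  have hdg : DifferentiableWithinAt 𝕜 (iteratedFDerivWithin 𝕜 m g s) s x :=
    differentiableWithinAt_of_linearIsometry_comp Λ hΛcl hu hx hdΛ
  refine ⟨hdg, ?_⟩
  ext v
  rw [iteratedFDerivWithin_succ_apply_left, fderivWithin_congr' hEq' hx,
    fderivWithin_linearIsometry_comp Λ hu hdg]
  simp [hΛ, iteratedFDerivWithin_succ_apply_left]

/-- **`C^n` regularity is detected after composition with a closed linear isometric embedding.**
If `ι : F →ₗᵢ G` is a linear isometry with closed range (automatic if `F` is complete), `s` is a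
set of unique differentiability and `ι ∘ g` is `C^n` on `s` (`n : ℕ∞`), then `g` is `C^n` on
`s`. Proof: by induction the iterated derivatives within `s` of `ι ∘ g` are the post-compositions
with `ι` of those of `g` (`iteratedFDerivWithin_linearIsometry_comp_step`), so continuity and
differentiability transfer (`contDiffOn_iff_continuousOn_differentiableOn`). The analytic case
`n = ω` is not treated. [folklore] -/
theorem contDiffOn_of_linearIsometry_comp (ι : F →ₗᵢ[𝕜] G) (hι : IsClosed (Set.range ι))
    {g : X → F} {s : Set X} (hs : UniqueDiffOn 𝕜 s) {n : ℕ∞} (h : ContDiffOn 𝕜 n (ι ∘ g) s) :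
    ContDiffOn 𝕜 n g s := by
  rw [contDiffOn_iff_continuousOn_differentiableOn hs] at h ⊢
  obtain ⟨hcont, hdiff⟩ := h
  have key : ∀ m : ℕ, (m : ℕ∞) ≤ n → EqOn (iteratedFDerivWithin 𝕜 m (ι ∘ g) s)
      (fun y => ι.toContinuousLinearMap.compContinuousMultilinearMap
        (iteratedFDerivWithin 𝕜 m g s y)) s := by
    intro m
    induction m with
    | zero =>
      intro _ x _
      ext v
      simp
    | succ m IH =>
      intro hm x hx
      have hm' : (m : ℕ∞) < n := lt_of_lt_of_le (by exact_mod_cast Nat.lt_succ_self m) hm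
      exact (iteratedFDerivWithin_linearIsometry_comp_step ι hι (hs x hx) hx (IH hm'.le)
        (hdiff m hm' x hx)).2
  refine ⟨fun m hm => ?_, fun m hm x hx => ?_⟩
  · have hiso : Isometry fun U : X [×m]→L[𝕜] F =>
        ι.toContinuousLinearMap.compContinuousMultilinearMap U :=
      AddMonoidHomClass.isometry_of_norm
        (ContinuousLinearMap.compContinuousMultilinearMapL 𝕜 (fun _ : Fin m => X) F G
          ι.toContinuousLinearMap) fun U => ι.norm_compContinuousMultilinearMap U
    exact hiso.comp_continuousOn_iff.1 ((hcont m hm).congr (key m hm).symm)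
  · exact (iteratedFDerivWithin_linearIsometry_comp_step ι hι (hs x hx) hx (key m hm.le)
      (hdiff m hm x hx)).1

/-- `C^n` regularity within a set of unique differentiability, at a point of the set, is detected
after composition with a linear isometry with closed range (`n : ℕ∞`). [folklore] -/
theorem contDiffWithinAt_of_linearIsometry_comp (ι : F →ₗᵢ[𝕜] G) (hι : IsClosed (Set.range ι))
    {g : X → F} {s : Set X} {x : X} (hs : UniqueDiffOn 𝕜 s) (hx : x ∈ s) {n : ℕ∞}
    (h : ContDiffWithinAt 𝕜 n (ι ∘ g) s x) : ContDiffWithinAt 𝕜 n g s x := by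
  rw [contDiffWithinAt_iff_forall_nat_le] at h ⊢
  intro m hm
  obtain ⟨U, hU, hxU, hmU⟩ := (h m hm).contDiffOn' le_rfl (by simp)
  rw [insert_eq_of_mem hx] at hmU
  exact (contDiffWithinAt_inter (hU.mem_nhds hxU)).1
    (contDiffOn_of_linearIsometry_comp ι hι (hs.inter hU) hmU x ⟨hx, hxU⟩)

/-- `C^n` regularity at a point is detected after composition with a linear isometry with closed
range (`n : ℕ∞`). [folklore] -/
theorem contDiffAt_of_linearIsometry_comp (ι : F →ₗᵢ[𝕜] G) (hι : IsClosed (Set.range ι))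
    {g : X → F} {x : X} {n : ℕ∞} (h : ContDiffAt 𝕜 n (ι ∘ g) x) : ContDiffAt 𝕜 n g x := by
  rw [← contDiffWithinAt_univ] at h ⊢
  exact contDiffWithinAt_of_linearIsometry_comp ι hι uniqueDiffOn_univ (mem_univ x) h

/-- `C^n` regularity is detected after composition with a linear isometry with closed range
(`n : ℕ∞`). [folklore] -/
theorem contDiff_of_linearIsometry_comp (ι : F →ₗᵢ[𝕜] G) (hι : IsClosed (Set.range ι))
    {g : X → F} {n : ℕ∞} (h : ContDiff 𝕜 n (ι ∘ g)) : ContDiff 𝕜 n g := by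
  rw [← contDiffOn_univ] at h ⊢
  exact contDiffOn_of_linearIsometry_comp ι hι uniqueDiffOn_univ h

/-- Iff form of `contDiffOn_of_linearIsometry_comp`. [folklore] -/
theorem contDiffOn_linearIsometry_comp_iff (ι : F →ₗᵢ[𝕜] G) (hι : IsClosed (Set.range ι))
    {g : X → F} {s : Set X} (hs : UniqueDiffOn 𝕜 s) {n : ℕ∞} :
    ContDiffOn 𝕜 n (ι ∘ g) s ↔ ContDiffOn 𝕜 n g s :=
  ⟨contDiffOn_of_linearIsometry_comp ι hι hs,
    fun h => h.continuousLinearMap_comp ι.toContinuousLinearMap⟩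

/-- Iff form of `contDiff_of_linearIsometry_comp`. [folklore] -/
theorem contDiff_linearIsometry_comp_iff (ι : F →ₗᵢ[𝕜] G) (hι : IsClosed (Set.range ι))
    {g : X → F} {n : ℕ∞} : ContDiff 𝕜 n (ι ∘ g) ↔ ContDiff 𝕜 n g :=
  ⟨contDiff_of_linearIsometry_comp ι hι, fun h => h.continuousLinearMap_comp ι.toContinuousLinearMap⟩

/-! ## Maps with values in a closed submodule, as maps into the submodule -/

section Submodule

variable (S : Submodule 𝕜 Z)

/-- The range of the isometric inclusion of a submodule is the submodule. [folklore] -/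
theorem range_subtypeₗᵢ : Set.range S.subtypeₗᵢ = (S : Set Z) := by
  ext z
  simp

/-- Restricting the codomain to a submodule `S` containing the values of `f` and of `f'`
preserves `HasFDerivAtFilter` (norms in `S` are computed in `Z`). [folklore] -/
theorem hasFDerivAtFilter_codRestrict {f : X → Z} {f' : X →L[𝕜] Z} {L : Filter (X × X)}
    (hf : ∀ x, f x ∈ S) (hf' : ∀ v, f' v ∈ S) (h : HasFDerivAtFilter f f' L) :
    HasFDerivAtFilter (fun x => (⟨f x, hf x⟩ : S)) (f'.codRestrict S hf') L :=
  (hasFDerivAtFilter_linearIsometry_comp_iff S.subtypeₗᵢ).1 h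

/-- Restricting the codomain to a submodule containing the values of `f` and `f'` preserves
`HasFDerivWithinAt`. [folklore] -/
theorem hasFDerivWithinAt_codRestrict {f : X → Z} {f' : X →L[𝕜] Z} {s : Set X} {x : X}
    (hf : ∀ x, f x ∈ S) (hf' : ∀ v, f' v ∈ S) (h : HasFDerivWithinAt f f' s x) :
    HasFDerivWithinAt (fun x => (⟨f x, hf x⟩ : S)) (f'.codRestrict S hf') s x :=
  hasFDerivAtFilter_codRestrict S hf hf' h

/-- Restricting the codomain to a submodule containing the values of `f` and `f'` preserves
`HasFDerivAt`. [folklore] -/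
theorem hasFDerivAt_codRestrict {f : X → Z} {f' : X →L[𝕜] Z} {x : X}
    (hf : ∀ x, f x ∈ S) (hf' : ∀ v, f' v ∈ S) (h : HasFDerivAt f f' x) :
    HasFDerivAt (fun x => (⟨f x, hf x⟩ : S)) (f'.codRestrict S hf') x :=
  hasFDerivAtFilter_codRestrict S hf hf' h

/-- Restricting the codomain to a submodule containing the values of `f` and `f'` preserves
`HasStrictFDerivAt`. [folklore] -/
theorem hasStrictFDerivAt_codRestrict {f : X → Z} {f' : X →L[𝕜] Z} {x : X}
    (hf : ∀ x, f x ∈ S) (hf' : ∀ v, f' v ∈ S) (h : HasStrictFDerivAt f f' x) :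
    HasStrictFDerivAt (fun x => (⟨f x, hf x⟩ : S)) (f'.codRestrict S hf') x :=
  hasFDerivAtFilter_codRestrict S hf hf' h

variable (hS : IsClosed (S : Set Z))
include hS

/-- A map with values in a closed submodule `S`, differentiable within a set `s` of unique
differentiability at `x ∈ s`, is differentiable there as a map into `S`, with derivative the
codomain restriction of `fderivWithin 𝕜 f s x` (which takes values in `S`,
`fderivWithin_mem_of_isClosed`). [folklore] -/
theorem hasFDerivWithinAt_codRestrict_fderivWithin {f : X → Z} {s : Set X} {x : X}
    (hf : ∀ x, f x ∈ S) (hu : UniqueDiffWithinAt 𝕜 s x) (hx : x ∈ s)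
    (h : DifferentiableWithinAt 𝕜 f s x) :
    HasFDerivWithinAt (fun x => (⟨f x, hf x⟩ : S))
      ((fderivWithin 𝕜 f s x).codRestrict S
        (fderivWithin_mem_of_isClosed S hS hu hx (fun y _ => hf y))) s x :=
  hasFDerivWithinAt_codRestrict S hf _ h.hasFDerivWithinAt

/-- A map with values in a closed submodule `S`, differentiable at `x`, is differentiable at `x`
as a map into `S`, with derivative the codomain restriction of `fderiv 𝕜 f x`. [folklore] -/
theorem hasFDerivAt_codRestrict_fderiv {f : X → Z} {x : X} (hf : ∀ x, f x ∈ S)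
    (h : DifferentiableAt 𝕜 f x) :
    HasFDerivAt (fun x => (⟨f x, hf x⟩ : S))
      ((fderiv 𝕜 f x).codRestrict S (fderiv_mem_of_isClosed S hS hf)) x :=
  hasFDerivAt_codRestrict S hf _ h.hasFDerivAt

/-- The derivative of the codomain restriction to a closed submodule is the codomain restriction
of the derivative. [folklore] -/
theorem fderiv_codRestrict {f : X → Z} {x : X} (hf : ∀ x, f x ∈ S)
    (h : DifferentiableAt 𝕜 f x) :
    fderiv 𝕜 (fun x => (⟨f x, hf x⟩ : S)) x =
      (fderiv 𝕜 f x).codRestrict S (fderiv_mem_of_isClosed S hS hf) :=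
  (hasFDerivAt_codRestrict_fderiv S hS hf h).fderiv

/-- **A `C^n` map with values in a closed submodule is `C^n` as a map into the submodule** (on a
set of unique differentiability; `n : ℕ∞`; normed spaces over any nontrivially normed field, no
completeness needed). [folklore] -/
theorem ContDiffOn.codRestrict_submodule {n : ℕ∞} {f : X → Z} {s : Set X}
    (hs : UniqueDiffOn 𝕜 s) (hf : ∀ x, f x ∈ S) (h : ContDiffOn 𝕜 n f s) :
    ContDiffOn 𝕜 n (fun x => (⟨f x, hf x⟩ : S)) s :=
  contDiffOn_of_linearIsometry_comp S.subtypeₗᵢ (by rw [range_subtypeₗᵢ]; exact hS) hs h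

/-- A `C^n` map with values in a closed submodule is `C^n` as a map into the submodule
(`n : ℕ∞`). [folklore] -/
theorem ContDiff.codRestrict_submodule {n : ℕ∞} {f : X → Z} (hf : ∀ x, f x ∈ S)
    (h : ContDiff 𝕜 n f) : ContDiff 𝕜 n (fun x => (⟨f x, hf x⟩ : S)) :=
  contDiff_of_linearIsometry_comp S.subtypeₗᵢ (by rw [range_subtypeₗᵢ]; exact hS) h

/-- A map with values in a closed submodule which is `C^n` at a point is `C^n` at that point as a
map into the submodule (`n : ℕ∞`). [folklore] -/
theorem ContDiffAt.codRestrict_submodule {n : ℕ∞} {f : X → Z} {x : X} (hf : ∀ x, f x ∈ S)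
    (h : ContDiffAt 𝕜 n f x) : ContDiffAt 𝕜 n (fun x => (⟨f x, hf x⟩ : S)) x :=
  contDiffAt_of_linearIsometry_comp S.subtypeₗᵢ (by rw [range_subtypeₗᵢ]; exact hS) h

/-- A map with values in a closed submodule which is `C^n` within a set of unique
differentiability at a point of the set is `C^n` there as a map into the submodule (`n : ℕ∞`).
[folklore] -/
theorem ContDiffWithinAt.codRestrict_submodule {n : ℕ∞} {f : X → Z} {s : Set X} {x : X}
    (hs : UniqueDiffOn 𝕜 s) (hx : x ∈ s) (hf : ∀ x, f x ∈ S) (h : ContDiffWithinAt 𝕜 n f s x) :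
    ContDiffWithinAt 𝕜 n (fun x => (⟨f x, hf x⟩ : S)) s x :=
  contDiffWithinAt_of_linearIsometry_comp S.subtypeₗᵢ (by rw [range_subtypeₗᵢ]; exact hS) hs hx h

/-- Iff form of `ContDiffOn.codRestrict_submodule`. [folklore] -/
theorem contDiffOn_codRestrict_submodule_iff {n : ℕ∞} {f : X → Z} {s : Set X}
    (hs : UniqueDiffOn 𝕜 s) (hf : ∀ x, f x ∈ S) :
    ContDiffOn 𝕜 n (fun x => (⟨f x, hf x⟩ : S)) s ↔ ContDiffOn 𝕜 n f s :=
  ⟨fun h => h.continuousLinearMap_comp S.subtypeL, ContDiffOn.codRestrict_submodule S hS hs hf⟩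

/-- Iff form of `ContDiff.codRestrict_submodule`. [folklore] -/
theorem contDiff_codRestrict_submodule_iff {n : ℕ∞} {f : X → Z} (hf : ∀ x, f x ∈ S) :
    ContDiff 𝕜 n (fun x => (⟨f x, hf x⟩ : S)) ↔ ContDiff 𝕜 n f :=
  ⟨fun h => h.continuousLinearMap_comp S.subtypeL, ContDiff.codRestrict_submodule S hS hf⟩

end Submodule

/-! ## Closed submodules of a product, componentwise -/

section Prod

variable {A : Type*} [NormedAddCommGroup A] [NormedSpace 𝕜 A]
  {B : Type*} [NormedAddCommGroup B] [NormedSpace 𝕜 B]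
  (p : Submodule 𝕜 (A × B)) (hp : IsClosed (p : Set (A × B)))
include hp

/-- Two `C^n` maps `f₁, f₂` on a set of unique differentiability whose pair takes values in a
closed submodule `p` of the product define a `C^n` map into `p` (`n : ℕ∞`). [folklore] -/
theorem ContDiffOn.subtype_mk_of_isClosed {n : ℕ∞} {f₁ : X → A} {f₂ : X → B} {s : Set X}
    (hs : UniqueDiffOn 𝕜 s) (hf : ∀ x, (f₁ x, f₂ x) ∈ p) (h₁ : ContDiffOn 𝕜 n f₁ s)
    (h₂ : ContDiffOn 𝕜 n f₂ s) : ContDiffOn 𝕜 n (fun x => (⟨(f₁ x, f₂ x), hf x⟩ : p)) s :=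
  ContDiffOn.codRestrict_submodule p hp hs hf (h₁.prodMk h₂)

/-- Two `C^n` maps `f₁, f₂` whose pair takes values in a closed submodule `p` of the product
define a `C^n` map into `p` (`n : ℕ∞`). [folklore] -/
theorem ContDiff.subtype_mk_of_isClosed {n : ℕ∞} {f₁ : X → A} {f₂ : X → B}
    (hf : ∀ x, (f₁ x, f₂ x) ∈ p) (h₁ : ContDiff 𝕜 n f₁) (h₂ : ContDiff 𝕜 n f₂) :
    ContDiff 𝕜 n (fun x => (⟨(f₁ x, f₂ x), hf x⟩ : p)) :=
  ContDiff.codRestrict_submodule p hp hf (h₁.prodMk h₂)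

/-- Two maps `f₁, f₂`, `C^n` at a point, whose pair takes values in a closed submodule `p` of the
product define a map into `p` which is `C^n` at that point (`n : ℕ∞`). [folklore] -/
theorem ContDiffAt.subtype_mk_of_isClosed {n : ℕ∞} {f₁ : X → A} {f₂ : X → B} {x : X}
    (hf : ∀ x, (f₁ x, f₂ x) ∈ p) (h₁ : ContDiffAt 𝕜 n f₁ x) (h₂ : ContDiffAt 𝕜 n f₂ x) :
    ContDiffAt 𝕜 n (fun x => (⟨(f₁ x, f₂ x), hf x⟩ : p)) x :=
  ContDiffAt.codRestrict_submodule p hp hf (h₁.prodMk h₂)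

end Prod

end Literature.Analysis.Calculus
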